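import Literature.Geometry.Kaehler.ComplexTorusCyclotomicAutomorphismSimpleIsomorphismClasses
import HarnessLib

/-!
# The finite-order endomorphisms of a simple complex torus with an automorphism of characteristic polynomial `Φ_d`
# (`d` odd) are the `±u^r`; every CM type of `ℚ(ζ_5)` is primitive, the `ζ_5`-surface has `Aut_tors = ±u^r ≅ μ_10`

Layer `Literature/Geometry/Kaehler`, namespace `Literature.Geometry.Kaehler.ComplexTorus`; lane `lit-hodgefound`
(Track 2 foundations library), Layer A2/A3 junction, row «A2-26(gb)» (self-proposed 2026-08-28, prover seat
`lit-hodgefound-p10`, generation 31, FILE 10).  FILE 7 proved the rigidity of the SIMPLE models: on a simple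
`ℂ^Φ/Φ(𝔞)` every endomorphism with `P = Φ_d` is `ζ_d^k` (`End_ℚ = ι(K)`, Shimura §5.1 Prop. 6).  THIS FILE runs the
same argument for endomorphisms of FINITE ORDER: they are `ι(α)` with `α` a root of unity of `K = ℚ(ζ_d)`, and for
odd `d` the roots of unity of `ℚ(ζ_d)` are the `±ζ_d^r` (Mathlib `IsPrimitiveRoot.exists_pow_or_neg_mul_pow_of_isOfFinOrder`).
Transported to any `(X, u) ≅ (ℂ^Φ/Φ(𝔞), ζ_d)` with `Φ` primitive (FILE 7 `exists_conj_of_iso`): THE FINITE-ORDER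
ENDOMORPHISMS OF `X` ARE EXACTLY THE `2d` ELEMENTS `±u^r`.  For `d = 5` all CM types are primitive — proved here in
the tree's `IsPrimitive (ℂ ≃+* ℂ)` vocabulary by a kernel `decide` over the residue sets modulo `5` through seat p29's
dictionary (`isPrimitive_iff_hasTrivialStabilizer`) — so the models `ℂ²/Φ(𝔞)` are SIMPLE abelian surfaces and the
`ζ_5`-surface of FILE 5 has exactly the ten finite-order endomorphisms `±u^r` (orders `1, 2, 5, 10`: no automorphism
of order `3`, `4`, `6`, `8` or `12`); for `d = 3` (one-dimensional tori are simple) the `ζ_3`-curve has the six `±u^r`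
(«`Aut E_ρ = μ_6`»).

WHAT IS PROVED (theorems only; no `def`, no instance, no named fact; net debt 0).
* §1 **`exists_eq_pow_or_neg_pow_of_isOfFinOrder`** (`d` odd, `ℂ^Φ/Φ(𝔞)` simple, `v ∈ End` of finite order ⟹
  `v = ±M_𝔞(ζ_d)^r`, `r < d`).
* §2 **`exists_eq_pow_or_neg_pow_of_isOfFinOrder_of_iso`** (the same on any `(X, u) ≅ (ℂ^Φ/Φ(𝔞), ζ_d)`:
  finite-order `v ∈ End X` ⟹ `v = ±u^r`), `pow_two_mul_eq_one_of_isOfFinOrder_of_iso` (`v^{2d} = 1`).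
* §3 `d = 5`: `hasTrivialStabilizer_of_isCMResidueSet_five` (`decide`), **`isPrimitive_of_isCyclotomicExtension_five`**
  (every CM type of a `{5}`-cyclotomic field is primitive), **`isSimple_periodIso_five`** (the models are simple),
  **`exists_eq_pow_or_neg_pow_of_isOfFinOrder_five`**, `pow_ten_eq_one_of_isOfFinOrder_five`,
  `orderOf_dvd_ten_of_isOfFinOrder_five`.
* §4 `d = 3`: `isSimple_periodIso_of_finrank_eq_two`, **`exists_eq_pow_or_neg_pow_of_isOfFinOrder_three`**,
  `pow_six_eq_one_of_isOfFinOrder_three`, `orderOf_dvd_six_of_isOfFinOrder_three`.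

Sources.  G. Shimura, *Abelian Varieties with Complex Multiplication and Modular Functions* (1998): §5.1 Prop. 6,
p. 37 (`End_ℚ(A) = ι(F)` for `A` simple of CM type); §8.2 Prop. 26, p. 69 (primitive ⟺ simple); §8.4 (2), p. 73
(«Therefore, our CM-type `(ℚ(ζ); {φ_i})` is primitive» — for `p = 5` every type is a transform of it, FILE 5).
Ch. Birkenhake, H. Lange, *Complex Abelian Varieties*, 2nd ed. (2004), §13.3 (automorphism groups of the abelian
varieties with an automorphism of order `d`, `φ(d) = 2g`) — not held (acq-10211), locator as cited by this lane's
earlier rows.  J. H. Silverman, *The Arithmetic of Elliptic Curves* (2009), III §10 Thm. 10.1 (`Aut E ≅ μ_6` for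
`j = 0`) as cited by the tree's elliptic-curve files.

## References

* [Shimura1998] G. Shimura, *Abelian Varieties with Complex Multiplication and Modular Functions*, Princeton
  Univ. Press (1998), §5.1 Prop. 6 p. 37, §8.2 Prop. 26 p. 69, §8.4 (2) p. 73.
* [BirkenhakeLange2004] Ch. Birkenhake, H. Lange, *Complex Abelian Varieties*, 2nd ed., Grundlehren 302 (2004), §13.3.
* [SilvermanAEC2009] J. H. Silverman, *The Arithmetic of Elliptic Curves*, 2nd ed., GTM 106 (2009), III §10 Thm. 10.1.
-/

noncomputable section

open scoped Classical nonZeroDivisors NumberField Manifold ContDiff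
open NumberField Module Polynomial

namespace Literature.Geometry.Kaehler

namespace ComplexTorus

-- `open scoped`: the tree's action of `Aut(ℂ)` on `Hom(K, ℂ)` by composition (`ringEquivCompAction`) is a scoped instance
open scoped Literature.NumberTheory.ComplexMultiplication
open Literature.AlgebraicGeometry.Motives (CMType)
open Literature.NumberTheory.ComplexMultiplication.CMTypeLattice (periodIso basisIndex card_basisIndex_eq_finrank
  leftMulMatrix_algebraMap_eq_map_mulMatrix endAlgRat_eq_range_leftMulMatrix_of_isSimple
  isSimple_periodIso_iff_isPrimitive)
open Literature.AlgebraicGeometry.ComplexMultiplication.CyclotomicCMTypeResidueSets (IsCMResidueSet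
  HasTrivialStabilizer residueSet isCMResidueSet_residueSet isPrimitive_iff_hasTrivialStabilizer)
-- `CMTypeLattice.mulMatrix I a` (multiplication by `a ∈ 𝓞 K` on the ideal `I`) is spelled with its namespace below:
-- the elliptic-curve files in the import cone declare a `ComplexTorus.mulMatrix` of their own.
open Literature.NumberTheory.ComplexMultiplication (CMTypeLattice.mulMatrix CMTypeLattice.mulMatrixHom
  CMTypeLattice.mulMatrixHom_apply)

/-! ### §1 Finite-order endomorphisms of a simple model are `±ζ_d^r` -/

section Model

variable {d : ℕ} [NeZero d] {K : Type} [Field K] [NumberField K] [IsCyclotomicExtension {d} ℚ K] {ζ : K}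
  (hζ : IsPrimitiveRoot ζ d)

include hζ in
/-- **THE FINITE-ORDER ENDOMORPHISMS OF A SIMPLE `ℂ^Φ/Φ(𝔞)` ARE `±ζ_d^r`** (`d` odd, `Φ` a primitive CM type of
`ℚ(ζ_d)`): `End_ℚ = ι(K)` for a simple torus («`A` is simple. Then … `End_ℚ(A)` coincides with `ι(F)`»), so a
finite-order `v` is `ι(α)` with `α` a root of unity of `ℚ(ζ_d)`, i.e. `α = ±ζ_d^r`.
[cite: Shimura1998, §5.1 Prop. 6 p. 37, §8.2 Prop. 26 p. 69] [cite: BirkenhakeLange2004, §13.3] -/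
theorem exists_eq_pow_or_neg_pow_of_isOfFinOrder (hodd : Odd d) {Φ : CMType K}
    {I : (FractionalIdeal (𝓞 K)⁰ K)ˣ} (hS : ComplexTorus.IsSimple (periodIso Φ I))
    {B : Matrix (basisIndex I) (basisIndex I) ℤ} (hB : B ∈ endRingInt (periodIso Φ I)) (hfin : IsOfFinOrder B) :
    ∃ r < d, B = CMTypeLattice.mulMatrix I hζ.toInteger ^ r ∨ B = -(CMTypeLattice.mulMatrix I hζ.toInteger ^ r) := by
  set F : Matrix (basisIndex I) (basisIndex I) ℤ →+* Matrix (basisIndex I) (basisIndex I) ℚ :=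
    (Int.castRingHom ℚ).mapMatrix with hFdef
  have hF : ∀ M, F M = M.map ((↑) : ℤ → ℚ) := fun M ↦ by rw [hFdef, RingHom.mapMatrix_apply, Int.coe_castRingHom]
  have hinj : Function.Injective F := fun M N h ↦
    Matrix.map_injective (Int.cast_injective (α := ℚ)) (by simpa [hFdef] using h)
  -- `B_ℚ = ι(α)`
  have h1 : B.map ((↑) : ℤ → ℚ) ∈ endAlgRat (periodIso Φ I) := (mem_endRingInt_iff (periodIso Φ I)).1 hB
  rw [endAlgRat_eq_range_leftMulMatrix_of_isSimple Φ I hS, AlgHom.mem_range] at h1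
  obtain ⟨α, hα⟩ := h1
  have hFB : F B = Algebra.leftMulMatrix (basisOfFractionalIdeal K I) α := by rw [hF]; exact hα.symm
  have hFM : F (CMTypeLattice.mulMatrix I hζ.toInteger) = Algebra.leftMulMatrix (basisOfFractionalIdeal K I) ζ := by
    rw [hF, ← leftMulMatrix_algebraMap_eq_map_mulMatrix]
    exact congrArg (Algebra.leftMulMatrix (basisOfFractionalIdeal K I)) hζ.coe_toInteger
  -- `α` has finite order
  obtain ⟨m, hm, hBm⟩ := hfin.exists_pow_eq_one
  have hαm : α ^ m = 1 := by
    apply Algebra.leftMulMatrix_injective (basisOfFractionalIdeal K I)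
    rw [map_pow, map_one, ← hFB, ← map_pow, hBm, map_one]
  obtain ⟨r, hr, hαr⟩ :=
    hζ.exists_pow_or_neg_mul_pow_of_isOfFinOrder hodd (isOfFinOrder_iff_pow_eq_one.2 ⟨m, hm, hαm⟩)
  refine ⟨r, hr, ?_⟩
  rcases hαr with h | h
  · refine Or.inl (hinj ?_)
    rw [hFB, h, map_pow, map_pow, hFM]
  · refine Or.inr (hinj ?_)
    rw [hFB, h, map_neg, map_pow, map_neg, map_pow, hFM]

end Model

/-! ### §2 … hence on any `(X, u) ≅ (ℂ^Φ/Φ(𝔞), ζ_d)` with `Φ` primitive: the finite-order endomorphisms are `±u^r` -/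

section Transport

variable {ι : Type} [Fintype ι] [DecidableEq ι] {E : Type} [NormedAddCommGroup E] [NormedSpace ℂ E]
  {P : (ι → ℝ) ≃L[ℝ] E} {d : ℕ} [NeZero d] {K : Type} [Field K] [NumberField K]
  [IsCyclotomicExtension {d} ℚ K] {ζ : K} (hζ : IsPrimitiveRoot ζ d)

omit [DecidableEq ι] in
/-- An intertwining `e ∘ ρ(A) = ρ(M) ∘ e` iterates: `e ∘ ρ(A^k) = ρ(M^k) ∘ e`. [folklore] -/
private theorem apply_mapMatrix_pow [DecidableEq ι] {ι' : Type} [Fintype ι'] [DecidableEq ι'] {E' : Type}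
    [NormedAddCommGroup E'] [NormedSpace ℂ E'] {P' : (ι' → ℝ) ≃L[ℝ] E'} (e : ComplexTorus P ≃+ ComplexTorus P')
    {A : Matrix ι ι ℤ} {M : Matrix ι' ι' ℤ} (hcomm : ∀ x, e (mapMatrix P P A x) = mapMatrix P' P' M (e x)) (k : ℕ)
    (x : ComplexTorus P) : e (mapMatrix P P (A ^ k) x) = mapMatrix P' P' (M ^ k) (e x) := by
  have h : Function.Semiconj e (mapMatrix P P A) (mapMatrix P' P' M) := hcomm
  have hk := h.iterate_right k x
  rwa [iterate_mapMatrix, iterate_mapMatrix] at hk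

/-- **THE FINITE-ORDER ENDOMORPHISMS OF `X` ARE THE `±u^r`** (`d` odd): if `(X, u) ≅ (ℂ^Φ/Φ(𝔞), ζ_d)` with
`ℂ^Φ/Φ(𝔞)` simple (`Φ` primitive), every endomorphism `v ∈ End X` of finite order is `u^r` or `−u^r` for some
`r < d` (transport `v` to the model by FILE 7 `exists_conj_of_iso`, §1, transport back).
[cite: Shimura1998, §5.1 Prop. 6 p. 37, §8.2 Prop. 26 p. 69] [cite: BirkenhakeLange2004, §13.3] -/
theorem exists_eq_pow_or_neg_pow_of_isOfFinOrder_of_iso (hodd : Odd d) {A : Matrix ι ι ℤ} {Φ : CMType K}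
    {I : (FractionalIdeal (𝓞 K)⁰ K)ˣ} (hS : ComplexTorus.IsSimple (periodIso Φ I))
    (e : ComplexTorus P ≃+ ComplexTorus (periodIso Φ I)) (he : ContMDiff 𝓘(ℂ, E) 𝓘(ℂ, Φ.1 → ℂ) ω e)
    (he₂ : ContMDiff 𝓘(ℂ, Φ.1 → ℂ) 𝓘(ℂ, E) ω e.symm)
    (hcomm : ∀ x : ComplexTorus P,
      e (mapMatrix P P A x) = mapMatrix (periodIso Φ I) (periodIso Φ I) (CMTypeLattice.mulMatrix I hζ.toInteger) (e x))
    {v : Matrix ι ι ℤ} (hv : v ∈ endRingInt P) (hfin : IsOfFinOrder v) :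
    ∃ r < d, v = A ^ r ∨ v = -(A ^ r) := by
  -- `v` on the model: `B` with `e⁻¹ ∘ B = v ∘ e⁻¹`
  obtain ⟨B, hB, -, hint⟩ := exists_conj_of_iso e.symm he₂ (by rw [AddEquiv.symm_symm]; exact he) hv
  -- `B` has finite order
  obtain ⟨m, hm, hvm⟩ := hfin.exists_pow_eq_one
  have hBm : B ^ m = 1 := by
    apply mapMatrix_injective (Φ := periodIso Φ I) (Φ' := periodIso Φ I)
    funext y
    apply e.symm.injective
    rw [apply_mapMatrix_pow e.symm hint m y, hvm, mapMatrix_one (Φ := P), mapMatrix_one (Φ := periodIso Φ I)]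
  obtain ⟨r, hr, hBr⟩ :=
    exists_eq_pow_or_neg_pow_of_isOfFinOrder hζ hodd hS hB (isOfFinOrder_iff_pow_eq_one.2 ⟨m, hm, hBm⟩)
  refine ⟨r, hr, ?_⟩
  -- transport back along `e`
  have hAr : ∀ x, e.symm (mapMatrix (periodIso Φ I) (periodIso Φ I) (CMTypeLattice.mulMatrix I hζ.toInteger ^ r) (e x)) =
      mapMatrix P P (A ^ r) x := fun x ↦ by
    rw [← apply_mapMatrix_pow e hcomm r x, AddEquiv.symm_apply_apply]
  have hv' : ∀ x, mapMatrix P P v x = e.symm (mapMatrix (periodIso Φ I) (periodIso Φ I) B (e x)) := fun x ↦ by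
    rw [hint, AddEquiv.symm_apply_apply]
  rcases hBr with h | h
  · refine Or.inl (mapMatrix_injective (Φ := P) (Φ' := P) (funext fun x ↦ ?_))
    rw [hv', h, hAr]
  · refine Or.inr (mapMatrix_injective (Φ := P) (Φ' := P) (funext fun x ↦ ?_))
    rw [hv', h, mapMatrix_neg, map_neg, hAr, mapMatrix_neg]

/-- … so `v^{2d} = 1` for every finite-order endomorphism (`(±u^r)^{2d} = u^{2dr} = 1`). [cite: BirkenhakeLange2004, §13.3] -/
theorem pow_two_mul_eq_one_of_isOfFinOrder_of_iso (hodd : Odd d) {A : Matrix ι ι ℤ}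
    (hP : A.charpoly = cyclotomic d ℤ) {Φ : CMType K} {I : (FractionalIdeal (𝓞 K)⁰ K)ˣ}
    (hS : ComplexTorus.IsSimple (periodIso Φ I)) (e : ComplexTorus P ≃+ ComplexTorus (periodIso Φ I))
    (he : ContMDiff 𝓘(ℂ, E) 𝓘(ℂ, Φ.1 → ℂ) ω e) (he₂ : ContMDiff 𝓘(ℂ, Φ.1 → ℂ) 𝓘(ℂ, E) ω e.symm)
    (hcomm : ∀ x : ComplexTorus P,
      e (mapMatrix P P A x) = mapMatrix (periodIso Φ I) (periodIso Φ I) (CMTypeLattice.mulMatrix I hζ.toInteger) (e x))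
    {v : Matrix ι ι ℤ} (hv : v ∈ endRingInt P) (hfin : IsOfFinOrder v) : v ^ (2 * d) = 1 := by
  obtain ⟨r, -, h⟩ := exists_eq_pow_or_neg_pow_of_isOfFinOrder_of_iso hζ hodd hS e he he₂ hcomm hv hfin
  have hAd : A ^ d = 1 := pow_eq_one_of_charpoly_eq_cyclotomic hP
  have hArd : (A ^ r) ^ (2 * d) = 1 := by rw [pow_right_comm, mul_comm 2 d, pow_mul, hAd, one_pow, one_pow]
  rcases h with rfl | rfl
  · exact hArd
  · rw [(even_two_mul d).neg_pow, hArd]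

end Transport

/-! ### §3 `ℚ(ζ_5)`: every CM type is primitive, the models are simple, `Aut_tors` of the `ζ_5`-surface is `±u^r` -/

section Five

variable {ι : Type} [Fintype ι] [DecidableEq ι] {E : Type} [NormedAddCommGroup E] [NormedSpace ℂ E]
  {P : (ι → ℝ) ≃L[ℝ] E}

/-- The finite check behind `isPrimitive_of_isCyclotomicExtension_five`: every CM residue set modulo `5` (one of
each pair `{c, −c}` of units) has trivial stabiliser in `(ℤ/5)ˣ`. [cite: Shimura1998, §8.4 (2) («`{1·a, …, n·a mod (p)}`
coincides with `{1, …, n mod (p)}` … so that `γ` is the identity»), p. 73] -/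
theorem hasTrivialStabilizer_of_isCMResidueSet_five :
    ∀ S : Finset (ZMod 5), IsCMResidueSet 5 S → HasTrivialStabilizer 5 S := by
  decide

/-- **EVERY CM TYPE OF `ℚ(ζ_5)` IS PRIMITIVE** (in the tree's group-theoretic sense `IsPrimitive (ℂ ≃+* ℂ) Φ s₀`,
Shimura §8.2 Prop. 26's `H′ = H_1`): all four types are transforms of Shimura's primitive `{φ_1, φ_2}` (FILE 5), or
directly — as here — every CM residue set mod `5` has trivial stabiliser (seat p29's `isPrimitive_iff_hasTrivialStabilizer`).
[cite: Shimura1998, §8.2 Prop. 26 p. 69, §8.4 (2) p. 73] -/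
theorem isPrimitive_of_isCyclotomicExtension_five {K : Type} [Field K] [NumberField K]
    [IsCyclotomicExtension {5} ℚ K] (Φ : CMType K) (s₀ : K →+* ℂ) :
    Literature.NumberTheory.ComplexMultiplication.IsPrimitive (ℂ ≃+* ℂ) Φ.1 s₀ := by
  rw [isPrimitive_iff_hasTrivialStabilizer 5]
  exact hasTrivialStabilizer_of_isCMResidueSet_five _ (isCMResidueSet_residueSet 5 Φ)

/-- **The models `ℂ²/Φ(𝔞)` for `ℚ(ζ_5)` are SIMPLE abelian surfaces** (primitive ⟺ simple, the tree's
`CMTypeLattice.isSimple_periodIso_iff_isPrimitive`). [cite: Shimura1998, §8.2 Prop. 26, p. 69] -/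
theorem isSimple_periodIso_five {K : Type} [Field K] [NumberField K] [IsCyclotomicExtension {5} ℚ K]
    (Φ : CMType K) (I : (FractionalIdeal (𝓞 K)⁰ K)ˣ) : ComplexTorus.IsSimple (periodIso Φ I) := by
  obtain ⟨s₀⟩ : Nonempty (K →+* ℂ) := inferInstance
  exact (isSimple_periodIso_iff_isPrimitive Φ I s₀).2 (isPrimitive_of_isCyclotomicExtension_five Φ s₀)

set_option backward.isDefEq.respectTransparency false in -- Mathlib's instance
-- `IsCyclotomicExtension {5} ℚ (CyclotomicField 5 ℚ)` is keyed on `CyclotomicField.algebra`, the goal on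
-- `DivisionRing.toRatAlgebra` (same workaround as FILE 1 `isAbelianVariety_of_charpoly_eq_cyclotomic`)
/-- **THE `ζ_5`-SURFACE: EVERY FINITE-ORDER ENDOMORPHISM IS ONE OF THE TEN `±u^r`.**  `X` a `2`-dimensional complex
torus with an endomorphism `u` of order `5` (FILES 2, 5: `X ≅ ℂ²/Φ(𝓞_{ℚ(ζ_5)})`, simple); then every `v ∈ End X` of
finite order is `u^r` or `−u^r`, `r < 5`. [cite: Shimura1998, §5.1 Prop. 6 p. 37, §8.4 (2) p. 73] [cite: BirkenhakeLange2004, §13.3] -/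
theorem exists_eq_pow_or_neg_pow_of_isOfFinOrder_five {A : Matrix ι ι ℤ} (hA : A ∈ endRingInt P)
    (hord : orderOf A = 5) (hdim : finrank ℂ E = 2) {v : Matrix ι ι ℤ} (hv : v ∈ endRingInt P)
    (hfin : IsOfFinOrder v) : ∃ r < 5, v = A ^ r ∨ v = -(A ^ r) := by
  have hζ := IsCyclotomicExtension.zeta_spec 5 ℚ (CyclotomicField 5 ℚ)
  obtain ⟨Φ, e, he, he', hcomm⟩ := exists_iso_periodIso_one_of_orderOf_eq_five hζ hA hord hdim
  exact exists_eq_pow_or_neg_pow_of_isOfFinOrder_of_iso hζ (by decide) (isSimple_periodIso_five Φ 1) e he he' hcomm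
    hv hfin

set_option backward.isDefEq.respectTransparency false in -- see above
/-- **… so `v^{10} = 1`** for every finite-order endomorphism of the `ζ_5`-surface. [cite: BirkenhakeLange2004, §13.3] -/
theorem pow_ten_eq_one_of_isOfFinOrder_five {A : Matrix ι ι ℤ} (hA : A ∈ endRingInt P) (hord : orderOf A = 5)
    (hdim : finrank ℂ E = 2) {v : Matrix ι ι ℤ} (hv : v ∈ endRingInt P) (hfin : IsOfFinOrder v) : v ^ 10 = 1 := by
  have hζ := IsCyclotomicExtension.zeta_spec 5 ℚ (CyclotomicField 5 ℚ)
  obtain ⟨Φ, e, he, he', hcomm⟩ := exists_iso_periodIso_one_of_orderOf_eq_five hζ hA hord hdim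
  exact pow_two_mul_eq_one_of_isOfFinOrder_of_iso hζ (by decide)
    (charpoly_eq_cyclotomic_of_orderOf_eq_of_finrank P Nat.prime_five.isPrimePow hord
      (by rw [hdim, Nat.totient_prime Nat.prime_five]))
    (isSimple_periodIso_five Φ 1) e he he' hcomm hv hfin

/-- **The orders of the finite-order endomorphisms of the `ζ_5`-surface divide `10`** (they are `1, 2, 5, 10`): the
surface has no automorphism of order `3, 4, 6, 8` or `12`. [cite: BirkenhakeLange2004, §13.3] -/
theorem orderOf_dvd_ten_of_isOfFinOrder_five {A : Matrix ι ι ℤ} (hA : A ∈ endRingInt P) (hord : orderOf A = 5)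
    (hdim : finrank ℂ E = 2) {v : Matrix ι ι ℤ} (hv : v ∈ endRingInt P) (hfin : IsOfFinOrder v) : orderOf v ∣ 10 :=
  orderOf_dvd_of_pow_eq_one (pow_ten_eq_one_of_isOfFinOrder_five hA hord hdim hv hfin)

end Five

/-! ### §4 `ℚ(ζ_3)`: the `ζ_3`-curve has `Aut_tors = ±u^r ≅ μ_6` -/

section Three

variable {ι : Type} [Fintype ι] [DecidableEq ι] {E : Type} [NormedAddCommGroup E] [NormedSpace ℂ E]
  {P : (ι → ℝ) ≃L[ℝ] E}

/-- **One-dimensional models are simple**: `ℂ/Φ(𝔞)` for an imaginary quadratic `K` (`[K : ℚ] = 2`) is a simple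
complex torus (a lattice of rank `2`; the tree's `isSimple_of_card_eq_two`). [cite: Shimura1998, §8.4 (1), p. 65] -/
theorem isSimple_periodIso_of_finrank_eq_two {K : Type} [Field K] [NumberField K] (h2 : finrank ℚ K = 2)
    (Φ : CMType K) (I : (FractionalIdeal (𝓞 K)⁰ K)ˣ) : ComplexTorus.IsSimple (periodIso Φ I) :=
  isSimple_of_card_eq_two (periodIso Φ I) (by rw [card_basisIndex_eq_finrank, h2])

set_option backward.isDefEq.respectTransparency false in -- see §3
/-- **THE `ζ_3`-CURVE: EVERY FINITE-ORDER ENDOMORPHISM IS ONE OF THE SIX `±u^r`** (`«Aut E = μ_6»` for `j = 0`):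
`X` a one-dimensional complex torus with an endomorphism `u` of order `3`; then every `v ∈ End X` of finite order
is `u^r` or `−u^r`, `r < 3`. [cite: SilvermanAEC2009, III §10 Thm. 10.1] [cite: BirkenhakeLange2004, §13.3 Cor. 13.3.4]
[cite: Shimura1998, §5.1 Prop. 6, p. 37] -/
theorem exists_eq_pow_or_neg_pow_of_isOfFinOrder_three {A : Matrix ι ι ℤ} (hA : A ∈ endRingInt P)
    (hord : orderOf A = 3) (hdim : finrank ℂ E = 1) {v : Matrix ι ι ℤ} (hv : v ∈ endRingInt P)
    (hfin : IsOfFinOrder v) : ∃ r < 3, v = A ^ r ∨ v = -(A ^ r) := by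
  have hζ := IsCyclotomicExtension.zeta_spec 3 ℚ (CyclotomicField 3 ℚ)
  have h2 : finrank ℚ (CyclotomicField 3 ℚ) = 2 := by
    rw [IsCyclotomicExtension.finrank (n := 3) (CyclotomicField 3 ℚ) (cyclotomic.irreducible_rat (by norm_num)),
      Nat.totient_prime Nat.prime_three]
  obtain ⟨Φ, e, he, he', hcomm⟩ := exists_iso_periodIso_one_of_orderOf_eq_three hζ hA hord hdim
  exact exists_eq_pow_or_neg_pow_of_isOfFinOrder_of_iso hζ (by decide) (isSimple_periodIso_of_finrank_eq_two h2 Φ 1)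
    e he he' hcomm hv hfin

set_option backward.isDefEq.respectTransparency false in -- see §3
/-- **… so `v^6 = 1`** for every finite-order endomorphism of the `ζ_3`-curve. [cite: SilvermanAEC2009, III §10 Thm. 10.1] -/
theorem pow_six_eq_one_of_isOfFinOrder_three {A : Matrix ι ι ℤ} (hA : A ∈ endRingInt P) (hord : orderOf A = 3)
    (hdim : finrank ℂ E = 1) {v : Matrix ι ι ℤ} (hv : v ∈ endRingInt P) (hfin : IsOfFinOrder v) : v ^ 6 = 1 := by
  have hζ := IsCyclotomicExtension.zeta_spec 3 ℚ (CyclotomicField 3 ℚ)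
  have h2 : finrank ℚ (CyclotomicField 3 ℚ) = 2 := by
    rw [IsCyclotomicExtension.finrank (n := 3) (CyclotomicField 3 ℚ) (cyclotomic.irreducible_rat (by norm_num)),
      Nat.totient_prime Nat.prime_three]
  obtain ⟨Φ, e, he, he', hcomm⟩ := exists_iso_periodIso_one_of_orderOf_eq_three hζ hA hord hdim
  exact pow_two_mul_eq_one_of_isOfFinOrder_of_iso hζ (by decide)
    (charpoly_eq_cyclotomic_of_orderOf_eq_of_finrank P Nat.prime_three.isPrimePow hord
      (by rw [hdim, Nat.totient_prime Nat.prime_three]))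
    (isSimple_periodIso_of_finrank_eq_two h2 Φ 1) e he he' hcomm hv hfin

/-- **The orders of the finite-order endomorphisms of the `ζ_3`-curve divide `6`.** [cite: SilvermanAEC2009, III §10 Thm. 10.1] -/
theorem orderOf_dvd_six_of_isOfFinOrder_three {A : Matrix ι ι ℤ} (hA : A ∈ endRingInt P) (hord : orderOf A = 3)
    (hdim : finrank ℂ E = 1) {v : Matrix ι ι ℤ} (hv : v ∈ endRingInt P) (hfin : IsOfFinOrder v) : orderOf v ∣ 6 :=
  orderOf_dvd_of_pow_eq_one (pow_six_eq_one_of_isOfFinOrder_three hA hord hdim hv hfin)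

end Three

end ComplexTorus

end Literature.Geometry.Kaehler
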